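import Literature.NumberTheory.EllipticCurves.BSDSelmerParityDokchitserProp417VerbatimProofs
import HarnessLib

/-!
# Step (4) of Dokchitser–Dokchitser's Thm. 4.19: the Cornut–Vatsal input in the multiplicity-one form of p. 27

Proofs companion (theorems, one auxiliary definition with a body; no named facts, D-0026) of
`BSDSelmerParityDokchitserProofs` for the named fact
`Literature.NumberTheory.EllipticCurves.dokchitser_selmerCorank_baseChange_mod_two_eq`
("`rk_p(E/M₀)` is odd": T. Dokchitser, V. Dokchitser, *On the Birch–Swinnerton-Dyer quotients
modulo squares*, Ann. of Math. 172 (2010), §4.6, step (4) of the proof of Thm. 4.19 = Thm. 1.4).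

The tree derives the named fact from Prop. 4.17 of the source (verbatim, `h417V`) and from the
CM-point input in the **growth form** `hCV`: "`rk_p(E/M_{n+1}) = rk_p(E/M_n) + (p - 1) pⁿ` for `n`
large" (`dokchitser_selmerCorank_baseChange_mod_two_eq_of_prop417_verbatim_of_hCV`, file
`BSDSelmerParityDokchitserProp417VerbatimProofs`). The printed sentence (p. 27) is

> "Now take `n` large enough. Then Cornut–Vatsal's Thm. 1.5 provides a primitive character `χ` of
> `Gal(F/M₀)` such that … By Tian–Zhang, … the `χ`-component of `X` has multiplicity 1. So `X`
> contains exactly one copy of the unique `(p-1)pⁿ`-dimensional `ℚ_p`-irreducible `p`-adic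
> representation of `Gal(F/M₀)`. Its restriction to `H` is `ρ^{⊕pⁿ}`, and no other representation
> contributes to `ρ`, so `m_ρ = pⁿ` is odd. (As an alternative … Cornut–Vatsal's Thm. 4.2 with
> Nekovář's Thm. 3.2. This directly yields a `χ` such that the `χ`-component of `X` has
> multiplicity 1.)"

with `F = M_{n+1}`, `X = X_p(E/F) = Hom(Sel_{p^∞}(E/F), ℚ_p/ℤ_p) ⊗ ℚ_p`. This file isolates the
deep input as the clause "**`X` contains exactly one copy of the unique `(p-1)pⁿ`-dimensional
`ℚ_p`-irreducible representation of `Gal(F/M₀)`**" and PROVES the remaining representation theory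
"its restriction to `H` is `ρ^{⊕pⁿ}`, and no other representation contributes to `ρ`, so
`m_ρ = pⁿ`", on the Selmer (Pontryagin-dual, discrete) side:

* `faithfulSelmerPart E F p hp σ n = ker Φ_{p^{n+1}}(σ_*) ⊆ Sel_{p^∞}(E_F/F)` — for
  `Gal(F/K) = ⟨σ⟩` cyclic of order `p^{n+1}`, the part of the Selmer group on which `Gal(F/K)`
  acts through `ℤ_p[ζ_{p^{n+1}}]`, i.e. through the unique faithful `ℚ_p`-irreducible
  representation; its `ℤ_p`-corank is `(p-1)pⁿ·a` with `a` the number of copies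
  (`exists_zpCorank_eq_totient_mul_of_aeval_cyclotomic_eq_zero`, file
  `ZpCorankCyclotomicPrimePow`), and "exactly one copy" is `corank = (p-1)pⁿ`;
* `selmerCorank_baseChange_eq_add_zpCorank_faithfulSelmerPart` —
  **`rk_p(E/F) = rk_p(E/M) + corank ker Φ_{p^{n+1}}(σ_*)`** for `F/K` cyclic of degree `p^{n+1}`
  with generator `σ` and `M/K` the subextension of degree `pⁿ` (`p` odd): Lemma 4.14 in the
  intrinsic form for `M ⊆ F` (`selmerCorank_baseChange_eq_zpCorank_selmerFixed`,
  `Aut(F/M)|_K = ⟨σ^{pⁿ}⟩`) and `corank A = corank A^{τ} + corank ker N_τ` for `τ = σ_*^{pⁿ}`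
  (`zpCorank_eq_zpCorank_fixedSub_add_zpCorank_kerNorm`), `N_τ = Φ_{p^{n+1}}(σ_*)`
  (`normEnd_pow_eq_aeval_cyclotomic`);
* `ZpExtension.exists_orderOf_eq_layer_succ` — `Gal(K_{n+1}/K)` has an element of order `p^{n+1}`
  (the restriction of a topological generator), and
  `selmerCorank_layer_succ_eq_add_zpCorank_faithfulSelmerPart` — the growth along the layers of
  any `ℤ_p`-extension of a number field;
* `hCV_of_multiplicity_one` — the multiplicity-one form `hMult` implies the growth form `hCV`;
* `dokchitser_selmerCorank_baseChange_mod_two_eq_of_prop417_verbatim_of_multiplicity_one` — the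
  named fact from Prop. 4.17 verbatim and `hMult`.

What remains hypothetical for the named fact is thus: Prop. 4.17 of the source (for elliptic
curves; §§4.1–4.3: Thm. 4.3 after Tate–Milne, Cor. 4.5 with the Cassels–Tate pairing, Thm. 4.7,
for products of Weil restrictions) and the CM-point theorem of Cornut–Vatsal with Tian–Zhang /
Nekovář in the form `hMult`; neither theory is in the tree (no CM points of conductor `pⁿ`, ring
class fields or `χ`-components of Heegner modules). Everything in this file is proved; no named
fact is introduced.

## References

* [DokchitserDokchitserAnnals2010] T. Dokchitser, V. Dokchitser, *On the Birch–Swinnerton-Dyer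
  quotients modulo squares*, Ann. of Math. 172 (2010), 567–596 = arXiv:math/0610290: Lemma 4.14
  (p. 24), §4.6 proof of Thm. 4.19 (pp. 26–27) — read (held, pp. 24–27).
* [CornutVatsal2007] C. Cornut, V. Vatsal, *Nontriviality of Rankin–Selberg L-functions and CM
  points*, in *L-functions and Galois representations* (Durham 2004), CUP 2007, Thm. 1.5, Thm. 4.2.
* [Nekovar2007] J. Nekovář, *The Euler system method for CM points on Shimura curves*, ibid.,
  Thm. 3.2.
* [Washington1997] L. C. Washington, *Introduction to Cyclotomic Fields*, 2nd ed., §13.1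
  (`Gal(K_n/K) ≅ ℤ/pⁿ`).
-/

noncomputable section

open scoped Classical AddSubgroup

open WeierstrassCurve Polynomial Field

namespace Literature.NumberTheory.EllipticCurves

open GaloisRepresentations

/-! ## The faithful part `ker Φ_{p^{n+1}}(σ_*)` of `Sel_{p^∞}(E_F/F)` and the growth in a cyclic `F/K` -/

section Faithful

variable {K : Type} [Field K] [NumberField K] (E : WeierstrassCurve K) [E.IsElliptic]
variable (F : Type) [Field F] [NumberField F] [Algebra K F] [IsGalois K F] (p : ℕ) [Fact p.Prime]

/-- **The faithful part of `Sel_{p^∞}(E_F/F)`** for `σ ∈ Aut(F/K)` at level `n`: the kernel of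
`Φ_{p^{n+1}}(σ_*)` on the Selmer group (`σ_* = selmerEnd`, the action through the chosen lift).
For `Gal(F/K) = ⟨σ⟩` cyclic of order `p^{n+1}` this is the part of `Sel_{p^∞}(E_F/F)` on which
`Gal(F/K)` acts through "the unique `(p-1)pⁿ`-dimensional `ℚ_p`-irreducible `p`-adic
representation" (Dokchitser–Dokchitser 2010, §4.6, p. 27), i.e. through `ℤ_p[ζ_{p^{n+1}}]`; its
`ℤ_p`-corank is `(p-1)pⁿ·a`, `a` the number of copies of that representation in `X_p(E/F)`
(`exists_zpCorank_eq_totient_mul_of_aeval_cyclotomic_eq_zero`).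
[cite: DokchitserDokchitserAnnals2010, §4.6, proof of Thm. 4.19 (p. 27)] -/
def faithfulSelmerPart (hp2 : p ≠ 2) (σ : F ≃ₐ[K] F) (n : ℕ) :
    AddSubgroup (selmerGroupPInfty (E.baseChange F) p) :=
  AddMonoidHom.ker (endHom (aeval (selmerEnd E F p hp2 σ) (cyclotomic (p ^ (n + 1)) ℤ)))

omit [NumberField K] [E.IsElliptic] [IsGalois K F] in
/-- `ker Φ_{p^{n+1}}(σ_*) = ker N_{σ_*^{pⁿ}}` (`Φ_{p^{n+1}}(X) = 1 + X^{pⁿ} + ⋯ + X^{pⁿ(p-1)}`,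
`normEnd_pow_eq_aeval_cyclotomic`). [folklore] -/
theorem kerNorm_selmerEnd_pow_eq_faithfulSelmerPart (hp2 : p ≠ 2) (σ : F ≃ₐ[K] F) (n : ℕ) :
    kerNorm (selmerEnd E F p hp2 σ ^ p ^ n) p = faithfulSelmerPart E F p hp2 σ n := by
  rw [kerNorm, faithfulSelmerPart, normEnd_pow_eq_aeval_cyclotomic]

/-- **`rk_p(E/F) = rk_p(E/M) + corank (ker Φ_{p^{n+1}}(σ_*))`** for `F/K` cyclic of degree `p^{n+1}`
with generator `σ`, `p` odd, and the subextension `M/K` of degree `pⁿ` (so `Gal(F/M) = ⟨σ^{pⁿ}⟩`):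
"`rk_p(E/M) = dim X^{Gal(F/M)}`" (Lemma 4.14, here `selmerCorank_baseChange_eq_zpCorank_selmerFixed`)
and `corank A = corank A^{τ} + corank ker N_τ` for `τ = σ_*^{pⁿ}`, `τ^p = 1`
(`zpCorank_eq_zpCorank_fixedSub_add_zpCorank_kerNorm`). Dokchitser–Dokchitser 2010, §4.6,
p. 27 ("Its restriction to `H` is `ρ^{⊕pⁿ}`, and no other representation contributes to `ρ`"):
the growth `rk_p(E/M_{n+1}) - rk_p(E/M_n) = (p-1) m_ρ` is the corank of the faithful part.
[cite: DokchitserDokchitserAnnals2010, §4.6, proof of Thm. 4.19 (p. 27), with Lemma 4.14] -/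
theorem selmerCorank_baseChange_eq_add_zpCorank_faithfulSelmerPart (hp2 : p ≠ 2) (n : ℕ)
    (hF : Module.finrank K F = p ^ (n + 1)) (σ : F ≃ₐ[K] F) (hσ : orderOf σ = p ^ (n + 1))
    (M : Type) [Field M] [NumberField M] [Algebra K M] [Algebra M F] [IsScalarTower K M F]
    (hM : Module.finrank K M = p ^ n) :
    (E.baseChange F).selmerCorank p =
      (E.baseChange M).selmerCorank p + zpCorank (faithfulSelmerPart E F p hp2 σ n) p := by
  have hprime : p.Prime := Fact.out
  haveI : FiniteDimensional K F := Module.Finite.of_restrictScalars_finite ℚ K F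
  haveI : FiniteDimensional K M := Module.Finite.of_restrictScalars_finite ℚ K M
  haveI : FiniteDimensional M F := Module.Finite.of_restrictScalars_finite K M F
  haveI : IsGalois M F := IsGalois.tower_top_of_isGalois K M F
  have hpn : p ^ n ≠ 0 := pow_ne_zero _ hprime.ne_zero
  -- degrees and cardinalities
  have hMF : Module.finrank M F = p := by
    have h := Module.finrank_mul_finrank K M F
    rw [hF, hM, pow_succ] at h
    exact Nat.eq_of_mul_eq_mul_left (Nat.pos_of_ne_zero hpn) h
  have hcardM : Nat.card (F ≃ₐ[M] F) = p := (IsGalois.card_aut_eq_finrank M F).trans hMF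
  have hcardK : Nat.card (F ≃ₐ[K] F) = p ^ (n + 1) := (IsGalois.card_aut_eq_finrank K F).trans hF
  -- `⟨σ⟩ = Aut(F/K)`
  have htop : Subgroup.zpowers σ = ⊤ := by
    apply Subgroup.eq_top_of_card_eq
    rw [Nat.card_zpowers, hσ, hcardK]
  -- `τ = σ^{pⁿ}` has order `p`
  set τ : F ≃ₐ[K] F := σ ^ p ^ n with hτdef
  have hτord : orderOf τ = p := by
    rw [hτdef, orderOf_pow' σ hpn, hσ, pow_succ, Nat.gcd_mul_right_left, Nat.mul_div_cancel_left _
      (Nat.pos_of_ne_zero hpn)]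
  have hτp : τ ^ p = 1 := by rw [← hτord]; exact pow_orderOf_eq_one τ
  -- `Aut(F/M)|_K ⊆ ⟨τ⟩`
  have hMres : ∀ ρ : F ≃ₐ[M] F, ∃ a : ℕ, ρ.restrictScalars K = τ ^ a := fun ρ ↦ by
    have hρp : (ρ.restrictScalars K) ^ p = 1 := by
      rw [← autRestrictHom_apply (R := K) F M, ← map_pow, ← hcardM, pow_card_eq_one', map_one]
    have hmem : ρ.restrictScalars K ∈ Submonoid.powers σ := by
      rw [Submonoid.mem_powers_iff]
      exact (mem_powers_iff_mem_zpowers.mpr (htop ▸ Subgroup.mem_top _) :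
        ρ.restrictScalars K ∈ Submonoid.powers σ)
    obtain ⟨j, hj⟩ := (Submonoid.mem_powers_iff _ _).mp hmem
    have hdvd : p ^ (n + 1) ∣ j * p := by
      rw [← hσ, orderOf_dvd_iff_pow_eq_one, pow_mul, hj, hρp]
    rw [pow_succ] at hdvd
    obtain ⟨a, ha⟩ := Nat.dvd_of_mul_dvd_mul_right hprime.pos hdvd
    refine ⟨a, ?_⟩
    rw [← hj, ha, pow_mul]
  -- `τ ∈ Aut(F/M)|_K`
  obtain ⟨ρM, hρM⟩ : ∃ ρM : F ≃ₐ[M] F, ρM.restrictScalars K = τ := by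
    let f : (F ≃ₐ[M] F) → Subgroup.zpowers τ := fun ρ ↦ ⟨ρ.restrictScalars K, by
      obtain ⟨a, ha⟩ := hMres ρ
      rw [ha]
      exact Subgroup.pow_mem _ (Subgroup.mem_zpowers τ) a⟩
    have hf : Function.Injective f := fun ρ ρ' h ↦
      AlgEquiv.restrictScalars_injective K (congrArg Subtype.val h :)
    have hcard : Nat.card (Subgroup.zpowers τ) ≤ Nat.card (F ≃ₐ[M] F) := by
      rw [Nat.card_zpowers, hτord, hcardM]
    obtain ⟨ρM, hρM⟩ := (hf.bijective_of_nat_card_le hcard).2 ⟨τ, Subgroup.mem_zpowers τ⟩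
    exact ⟨ρM, congrArg Subtype.val hρM⟩
  have hMfix : selmerFixed E F p (Set.range (AlgEquiv.restrictScalars K : (F ≃ₐ[M] F) → (F ≃ₐ[K] F))) =
      selmerFixed E F p {τ} := by
    refine selmerFixed_eq_of_forall E F p (fun s _ hs ρ hρ ↦ ?_) (fun s _ hs ρ hρ ↦ ?_)
    · rw [Set.mem_singleton_iff.mp hρ, ← hρM]
      exact hs _ ⟨ρM, rfl⟩
    · obtain ⟨ρ, rfl⟩ := hρ
      obtain ⟨a, ha⟩ := hMres ρ
      rw [ha]
      exact autAct_pow_eq_self E F p (hs τ rfl) a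
  -- the module `A = Sel_{p^∞}(E_F/F)` with `s = σ_*`
  set s : AddMonoid.End (selmerGroupPInfty (E.baseChange F) p) := selmerEnd E F p hp2 σ with hsdef
  have hsτ : selmerEnd E F p hp2 τ = s ^ p ^ n := by rw [hτdef, selmerEnd_pow]
  have hsp : (s ^ p ^ n) ^ p = 1 := by
    rw [← hsτ, ← selmerEnd_pow, hτp, selmerEnd_one]
  have hA : ∀ a : selmerGroupPInfty (E.baseChange F) p, ∃ m : ℕ, p ^ m • a = 0 := fun a ↦ by
    obtain ⟨m, hm⟩ := exists_pow_nsmul_eq_zero_galH1Primary (E.baseChange F) p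
      (a : galH1Primary (E.baseChange F) p)
    exact ⟨m, Subtype.ext (by rw [AddSubmonoidClass.coe_nsmul]; exact hm)⟩
  haveI : Finite (selmerGroupPInfty (E.baseChange F) p)[(p : ℤ)] :=
    finite_torsionBy_selmerGroupPInfty (E.baseChange F) p
  have hsplit := zpCorank_eq_zpCorank_fixedSub_add_zpCorank_kerNorm hsp hA
  -- the two coranks
  have hM' : zpCorank (fixedSub (s ^ p ^ n)) p = (E.baseChange M).selmerCorank p := by
    rw [selmerCorank_baseChange_eq_zpCorank_selmerFixed E F p M, hMfix,
      zpCorank_congr (selmerFixedSingletonEquiv E F p hp2 τ) p, hsτ]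
  have hF' : zpCorank (selmerGroupPInfty (E.baseChange F) p) p = (E.baseChange F).selmerCorank p := rfl
  rw [← hF', hsplit, hM', kerNorm_selmerEnd_pow_eq_faithfulSelmerPart]

end Faithful

/-! ## Generators of `Gal(K_{n+1}/K)` for a `ℤ_p`-extension -/

namespace ZpExtension

variable {K : Type} [Field K] [NumberField K] {p : ℕ} [Fact p.Prime] (κ : ZpExtension K p)

/-- **`Gal(K_{n+1}/K)` has an element of order `p^{n+1}`** (it is cyclic of that order, generated
by the restriction of a topological generator `γ`: `γ^{p^{n+1}} ∈ Gal(K̄/K_{n+1})` and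
`γ^{pⁿ} ∉ Gal(K̄/K_{n+1})`). Washington, *Introduction to Cyclotomic Fields*, §13.1.
[cite: Washington1997, §13.1] -/
theorem exists_orderOf_eq_layer_succ (n : ℕ) :
    ∃ σ : (κ.layer (n + 1)) ≃ₐ[K] (κ.layer (n + 1)), orderOf σ = p ^ (n + 1) := by
  obtain ⟨γ, hγ⟩ := κ.exists_isTopGenerator
  let σ : (κ.layer (n + 1)) ≃ₐ[K] (κ.layer (n + 1)) :=
    AlgEquiv.restrictNormal (absoluteGaloisGroup.toAlgEquiv K γ) (κ.layer (n + 1))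
  have hσ_coe : ∀ x : κ.layer (n + 1),
      ((σ x : κ.layer (n + 1)) : AlgebraicClosure K) = γ • (x : AlgebraicClosure K) :=
    fun x ↦ AlgEquiv.restrictNormal_apply (κ.layer (n + 1)) _ x
  have hσk_coe : ∀ (k : ℕ) (x : κ.layer (n + 1)),
      (((σ ^ k) x : κ.layer (n + 1)) : AlgebraicClosure K) = (γ ^ k) • (x : AlgebraicClosure K) := by
    intro k
    induction k with
    | zero => intro x; rw [pow_zero, pow_zero, AlgEquiv.one_apply, one_smul]
    | succ k ih => intro x; rw [pow_succ, AlgEquiv.mul_apply, ih, hσ_coe, ← mul_smul, ← pow_succ]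
  refine ⟨σ, orderOf_eq_prime_pow (fun h1 ↦ ?_) ?_⟩
  · -- `σ^{pⁿ} ≠ 1`
    apply pow_prime_pow_not_mem_layerSubgroup_succ hγ n
    have hfix : absoluteGaloisGroup.toAlgEquiv K (γ ^ p ^ n) ∈ (κ.layer (n + 1)).fixingSubgroup := by
      rw [IntermediateField.mem_fixingSubgroup_iff]
      intro x hx
      have h := hσk_coe (p ^ n) ⟨x, hx⟩
      rw [h1, AlgEquiv.one_apply, absoluteGaloisGroup.smul_def] at h
      exact h.symm
    rw [κ.fixingSubgroup_layer (n + 1)] at hfix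
    obtain ⟨τ, hτ, hτeq⟩ := Subgroup.mem_map.mp hfix
    have hττ : τ = γ ^ p ^ n := (absoluteGaloisGroup.toAlgEquiv K).injective hτeq
    rwa [hττ] at hτ
  · -- `σ^{p^{n+1}} = 1`
    refine AlgEquiv.ext fun x ↦ Subtype.ext ?_
    rw [hσk_coe, AlgEquiv.one_apply]
    exact (mem_layer_iff κ (n + 1) _).mp x.2 _ (κ.pow_mem_layerSubgroup hγ (n + 1))

end ZpExtension

/-! ## The growth `rk_p(E/K_{n+1}) = rk_p(E/K_n) + corank(faithful part)` along a `ℤ_p`-tower -/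

section Tower

variable {K : Type} [Field K] [NumberField K] (E : WeierstrassCurve K) [E.IsElliptic]
  {p : ℕ} [Fact p.Prime] (κ : ZpExtension K p)

/-- **`rk_p(E/K_{n+1}) = rk_p(E/K_n) + corank ker Φ_{p^{n+1}}(σ_*)`** along the layers of a
`ℤ_p`-extension, for any generator `σ` of `Gal(K_{n+1}/K)` (`p` odd)
(`selmerCorank_baseChange_eq_add_zpCorank_faithfulSelmerPart` with `M = K_n`, `F = K_{n+1}`).
Dokchitser–Dokchitser 2010, §4.6, p. 27.
[cite: DokchitserDokchitserAnnals2010, §4.6, proof of Thm. 4.19 (p. 27), with Lemma 4.14] -/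
theorem selmerCorank_layer_succ_eq_add_zpCorank_faithfulSelmerPart (hp2 : p ≠ 2) (n : ℕ)
    (σ : (κ.layer (n + 1)) ≃ₐ[K] (κ.layer (n + 1))) (hσ : orderOf σ = p ^ (n + 1)) :
    (E.baseChange (κ.layer (n + 1))).selmerCorank p =
      (E.baseChange (κ.layer n)).selmerCorank p +
        zpCorank (faithfulSelmerPart E (κ.layer (n + 1)) p hp2 σ n) p := by
  letI : Algebra (κ.layer n) (κ.layer (n + 1)) :=
    (IntermediateField.inclusion (κ.layer_mono n.le_succ)).toRingHom.toAlgebra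
  haveI : IsScalarTower K (κ.layer n) (κ.layer (n + 1)) :=
    IsScalarTower.of_algebraMap_eq fun _ ↦ rfl
  exact selmerCorank_baseChange_eq_add_zpCorank_faithfulSelmerPart E (κ.layer (n + 1)) p hp2 n
    (κ.finrank_layer_holds (n + 1)) σ hσ (κ.layer n) (κ.finrank_layer_holds n)

end Tower

/-! ## The Cornut–Vatsal / Tian–Zhang–Nekovář input in the multiplicity-one form of p. 27 -/

section MultiplicityOne

/-- **The multiplicity-one form implies the growth form.** Hypothesis `hMult` — Dokchitser–
Dokchitser 2010, §4.6, p. 27, the sentence "So `X` [`= X_p(E/M_{n+1})`] contains exactly one copy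
of the unique `(p-1)pⁿ`-dimensional `ℚ_p`-irreducible `p`-adic representation of
`Gal(F/M₀)`" (for `n` large; from Cornut–Vatsal Thm. 1.5 with Yuan–Zhang–Zhang and Tian–Zhang,
or Cornut–Vatsal Thm. 4.2 with Nekovář Thm. 3.2), transcribed on `ℤ_p`-coranks: for `E = W_{M₀}`,
`M₀ = K` imaginary quadratic with the Heegner hypothesis, `κ` anticyclotomic and every generator
`σ` of `Gal(M_{n+1}/M₀)`, the faithful part `ker Φ_{p^{n+1}}(σ_*)` of `Sel_{p^∞}(E/M_{n+1})` has
corank exactly `(p-1)pⁿ` (one copy). Conclusion: the hypothesis `hCV` of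
`dokchitser_selmerCorank_baseChange_mod_two_eq_of_prop417_verbatim_of_hCV`
("so `m_ρ = pⁿ`": `rk_p(E/M_{n+1}) = rk_p(E/M_n) + (p-1)pⁿ` for `n` large), by
`selmerCorank_layer_succ_eq_add_zpCorank_faithfulSelmerPart` ("its restriction to `H` is
`ρ^{⊕pⁿ}`, and no other representation contributes to `ρ`").
[cite: DokchitserDokchitserAnnals2010, §4.6, proof of Thm. 4.19 (p. 27)]
[cite: CornutVatsal2007, Thm. 1.5 and Thm. 4.2] [cite: Nekovar2007, Thm. 3.2] -/
theorem hCV_of_multiplicity_one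
    (hMult : ∀ (W : WeierstrassCurve ℚ) [W.IsElliptic] (p : ℕ) [Fact p.Prime] (hp : p ≠ 2)
      (K : Type) [Field K] [NumberField K], IsImaginaryQuadratic K →
        SatisfiesHeegnerHypothesis (W.conductorNorm ℤ) K →
          ∀ (κ : ZpExtension K p), κ.IsAnticyclotomic → ∃ n₀ : ℕ, ∀ n ≥ n₀,
            ∀ (σ : (κ.layer (n + 1)) ≃ₐ[K] (κ.layer (n + 1))), orderOf σ = p ^ (n + 1) →
              zpCorank (faithfulSelmerPart (W.baseChange K) (κ.layer (n + 1)) p hp σ n) p =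
                (p - 1) * p ^ n) :
    ∀ (W : WeierstrassCurve ℚ) [W.IsElliptic] (p : ℕ) [Fact p.Prime], p ≠ 2 →
      ∀ (K : Type) [Field K] [NumberField K], IsImaginaryQuadratic K →
        SatisfiesHeegnerHypothesis (W.conductorNorm ℤ) K →
          ∀ (κ : ZpExtension K p), κ.IsAnticyclotomic → ∃ n₀ : ℕ, ∀ n ≥ n₀,
            (W.baseChange (κ.layer (n + 1))).selmerCorank p =
              (W.baseChange (κ.layer n)).selmerCorank p + (p - 1) * p ^ n := by
  intro W _ p _ hp K _ _ hK hH κ hκ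
  obtain ⟨n₀, hn₀⟩ := hMult W p hp K hK hH κ hκ
  refine ⟨n₀, fun n hn ↦ ?_⟩
  obtain ⟨σ, hσ⟩ := κ.exists_orderOf_eq_layer_succ n
  have h := selmerCorank_layer_succ_eq_add_zpCorank_faithfulSelmerPart (W.baseChange K) κ hp n σ hσ
  rw [hn₀ n hn σ hσ, baseChange_baseChange_of_rat, baseChange_baseChange_of_rat] at h
  exact h

/-- **The named fact `dokchitser_selmerCorank_baseChange_mod_two_eq` from Prop. 4.17 verbatim and
the multiplicity-one input** (Dokchitser–Dokchitser 2010, §4.6, step (4) of the proof of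
Thm. 4.19 = Thm. 1.4: `rk_p(E/M₀)` is odd). Hypotheses: `h417V` — Prop. 4.17 of the source for
elliptic curves, as printed (`prop417_p27_of_prop417_verbatim`); `hMult` — "`X` contains exactly
one copy of the unique `(p-1)pⁿ`-dimensional `ℚ_p`-irreducible `p`-adic representation of
`Gal(M_{n+1}/M₀)`" for `n` large (`hCV_of_multiplicity_one`), the output of Cornut–Vatsal's theorem
with Tian–Zhang / Nekovář. Every other sentence of the printed proof of step (4) is a theorem of
the tree; what remains hypothetical is Prop. 4.17 itself (§§4.1–4.3) and the CM-point theorem.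
[cite: DokchitserDokchitserAnnals2010, Prop. 4.17 (p. 25) and §4.6, proof of Thm. 4.19 (= Thm. 1.4), pp. 26–27]
[cite: CornutVatsal2007, Thm. 1.5 and Thm. 4.2] [cite: Nekovar2007, Thm. 3.2] -/
theorem dokchitser_selmerCorank_baseChange_mod_two_eq_of_prop417_verbatim_of_multiplicity_one
    (h417V : ∀ (p : ℕ) [Fact p.Prime], p ≠ 2 →
      ∀ (R : Type) [Field R] [NumberField R] (F : Type) [Field F] [NumberField F] [Algebra R F]
        [IsGalois R F], Nonempty ((F ≃ₐ[R] F) ≃* DihedralGroup p) →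
        ∀ (M : Type) [Field M] [NumberField M] [Algebra R M] [Algebra M F] [IsScalarTower R M F],
          Module.finrank R M = 2 →
        ∀ (L : Type) [Field L] [NumberField L] [Algebra R L] [Algebra L F] [IsScalarTower R L F],
          Module.finrank R L = p →
          ∀ (E : WeierstrassCurve R) [E.IsElliptic],
            ((E.baseChange M).selmerCorank p : ℤ) +
                2 * (((E.baseChange L).selmerCorank p : ℤ) - (E.selmerCorank p : ℤ)) / ((p : ℤ) - 1) ≡
              padicValRat p ((E.baseChange F).modifiedTamagawaProduct /
                (E.baseChange M).modifiedTamagawaProduct) [ZMOD 2])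
    (hMult : ∀ (W : WeierstrassCurve ℚ) [W.IsElliptic] (p : ℕ) [Fact p.Prime] (hp : p ≠ 2)
      (K : Type) [Field K] [NumberField K], IsImaginaryQuadratic K →
        SatisfiesHeegnerHypothesis (W.conductorNorm ℤ) K →
          ∀ (κ : ZpExtension K p), κ.IsAnticyclotomic → ∃ n₀ : ℕ, ∀ n ≥ n₀,
            ∀ (σ : (κ.layer (n + 1)) ≃ₐ[K] (κ.layer (n + 1))), orderOf σ = p ^ (n + 1) →
              zpCorank (faithfulSelmerPart (W.baseChange K) (κ.layer (n + 1)) p hp σ n) p =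
                (p - 1) * p ^ n) :
    dokchitser_selmerCorank_baseChange_mod_two_eq :=
  dokchitser_selmerCorank_baseChange_mod_two_eq_of_prop417_verbatim_of_hCV h417V
    (hCV_of_multiplicity_one hMult)

end MultiplicityOne

end Literature.NumberTheory.EllipticCurves
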